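import Summits.BirchSwinnertonDyer.BirchSwinnertonDyer.Theorems.ResidualThetaTransportAtTwoSignedMuSeedAtTwoPlusJetTranslation
import Literature.NumberTheory.EllipticCurves.FormalGroupLaurentPoints
import Literature.NumberTheory.EllipticCurves.FormalGroupNegOmegaProofs
import HarnessLib

/-!
# J1 of `jet-character-sums` on the TREE'S FORMAL POINT: for `Ẽ = y² + y = x³` over a field `k` of characteristic `2` and the
# formal point `T(σ) = (x(σ), y(σ)) ∈ Ẽ(k⸨X⸩)` (`WeierstrassCurve.laurentX/laurentY`, any parameter `σ ∈ X k⟦X⟧ ∖ 0`),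
# `x(Q′ ⊕ T(σ)) = x′ + w(σ)(1 + x′²σ + y′²w(σ))/(σ + x′w(σ))²` — Mathlib's chord law, the card's shape VERBATIM
# (crux `SignedMuSeedAtTwoPlus` stmt-BirchSwinnertonDyer-21438; Kμ⁺ stmt-BirchSwinnertonDyer-20689; route `ResidualThetaTransportAtTwo`)

Cell `bsd-wall`, width seat `bsd-wall-rtt-p4-w2` (g12). THEOREMS ONLY (no `def`, no named fact, no `sorry`); helper `--supports` the
seed crux; nothing about any habitat curve is asserted; BSD is not proved by this. The line card asked for J1 «as a statement about
`WeierstrassCurve.Affine.Point` of `⟨0,0,1,0,0⟩` over `LaurentSeries k` using Mathlib's `addX`/`slope`». `…JetTranslation.addX_translate`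
(p671421) is that statement for abstract `z, w` in any field of characteristic `2`; this file instantiates it on the tree's formal point
of `Literature/…/FormalGroupLaurentPoints.lean` (`laurentX E σ = X(σ)/σ²`, `laurentY E σ = −X(σ)/σ³`, `X = formalXMulSq`):

* `formalW_subst_eq_cube_add_sq` — `w(σ) = σ³ + w(σ)²` (AEC IV.1.1 substituted); `formalW_subst_eq_cube_mul` — `w(σ) = σ³·B(σ)`,
  `formalW_subst_ne_zero`; `formalXMulSq_subst_mul_formalW_subst` — `X(σ)·w(σ) = σ³`;
* `laurentX_eq_div`, `laurentY_eq_div` — **`x(σ) = σ/w(σ)`, `y(σ) = 1/w(σ)`** in `k⸨X⸩` (characteristic `2`: `−1/w = 1/w`);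
* **`laurent_addX_translate`** — for `Q′ = (x′, y′)` with `x′ y′ ∈ k` arbitrary and `σ ≠ 0`, `σ(0) = 0`:
  `addX x′ x(σ) (slope x′ x(σ) y′ y(σ)) = x′ + w(σ)(1 + x′²σ + y′²w(σ))/(σ + x′w(σ))²` on `Ẽ.baseChange k⸨X⸩`.
  With `σ = X` and `…JetTranslation.translationJet` this is the card's `x(Q′ ⊕ T(t)) = x′ + t + x′²t² + (y′²+1)t⁴ + x′⁴t⁶ + O(t⁸)`.

References: [SilvermanAEC2009] III.2.3, IV.1.1; the card (stub J1).
-/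

set_option autoImplicit false
set_option linter.dupNamespace false

noncomputable section

open scoped Classical LaurentSeries

open PowerSeries

namespace Summit.BirchSwinnertonDyer.BirchSwinnertonDyer.Theorems.SignedMuAtTwo.JetCharacterSums

variable {k : Type*} [Field k]

/-- `w(σ) = σ³ + w(σ)²` for `Ẽ = ⟨0,0,1,0,0⟩` and any parameter `σ` with `σ(0) = 0` (substitute into `w = X³ + w²`).
[cite: SilvermanAEC2009, IV.1.1] -/
theorem formalW_subst_eq_cube_add_sq {σ : k⟦X⟧} (h0 : constantCoeff σ = 0) :
    (⟨0, 0, 1, 0, 0⟩ : WeierstrassCurve k).formalW.subst σ =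
      σ ^ 3 + ((⟨0, 0, 1, 0, 0⟩ : WeierstrassCurve k).formalW.subst σ) ^ 2 := by
  have hs : HasSubst σ := HasSubst.of_constantCoeff_zero' h0
  have h := congrArg (PowerSeries.subst σ) (formalW_eq_X_pow_three_add_sq k)
  rw [← PowerSeries.coe_substAlgHom hs, map_add, map_pow, map_pow, PowerSeries.substAlgHom_X] at h
  rw [← PowerSeries.coe_substAlgHom hs]
  exact h

/-- `w(σ) = σ³ · B(σ)` with `B = formalWDivCube` (`B(0) = 1`). [cite: SilvermanAEC2009, IV.1.1] -/
theorem formalW_subst_eq_cube_mul {σ : k⟦X⟧} (h0 : constantCoeff σ = 0) :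
    (⟨0, 0, 1, 0, 0⟩ : WeierstrassCurve k).formalW.subst σ =
      σ ^ 3 * ((⟨0, 0, 1, 0, 0⟩ : WeierstrassCurve k).formalWDivCube.subst σ) := by
  have hs : HasSubst σ := HasSubst.of_constantCoeff_zero' h0
  have h := congrArg (PowerSeries.subst σ) ((⟨0, 0, 1, 0, 0⟩ : WeierstrassCurve k).formalW_eq_X_pow_mul_formalWDivCube)
  rw [← PowerSeries.coe_substAlgHom hs, map_mul, map_pow, PowerSeries.substAlgHom_X] at h
  rw [← PowerSeries.coe_substAlgHom hs]
  exact h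

/-- `w(σ) ≠ 0` for `σ ≠ 0` with `σ(0) = 0`. [cite: SilvermanAEC2009, IV.1.1] -/
theorem formalW_subst_ne_zero {σ : k⟦X⟧} (h0 : constantCoeff σ = 0) (hσ : σ ≠ 0) :
    (⟨0, 0, 1, 0, 0⟩ : WeierstrassCurve k).formalW.subst σ ≠ 0 := by
  rw [formalW_subst_eq_cube_mul h0]
  refine mul_ne_zero (pow_ne_zero 3 hσ) fun h => ?_
  have h1 : constantCoeff (((⟨0, 0, 1, 0, 0⟩ : WeierstrassCurve k).formalWDivCube).subst σ) = 1 := by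
    rw [Literature.RingTheory.FormalGroups.constantCoeff_subst_of_constantCoeff_eq_zero h0,
      WeierstrassCurve.constantCoeff_formalWDivCube]
  rw [h, map_zero] at h1
  exact zero_ne_one h1

/-- `X(σ) · w(σ) = σ³` (`x = z/w` with poles cleared, substituted). [cite: SilvermanAEC2009, IV.1.1] -/
theorem formalXMulSq_subst_mul_formalW_subst {σ : k⟦X⟧} (h0 : constantCoeff σ = 0) :
    (⟨0, 0, 1, 0, 0⟩ : WeierstrassCurve k).formalXMulSq.subst σ *
        (⟨0, 0, 1, 0, 0⟩ : WeierstrassCurve k).formalW.subst σ = σ ^ 3 := by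
  have hs : HasSubst σ := HasSubst.of_constantCoeff_zero' h0
  rw [← PowerSeries.coe_substAlgHom hs, ← map_mul, WeierstrassCurve.formalXMulSq_mul_formalW, map_pow,
    PowerSeries.substAlgHom_X]

/-- **`x(σ) = σ / w(σ)`** in `k⸨X⸩`. [cite: SilvermanAEC2009, IV.1.1] -/
theorem laurentX_eq_div {σ : k⟦X⟧} (h0 : constantCoeff σ = 0) (hσ : σ ≠ 0) :
    (⟨0, 0, 1, 0, 0⟩ : WeierstrassCurve k).laurentX σ =
      ((σ : k⟦X⟧) : k⸨X⸩) / (((⟨0, 0, 1, 0, 0⟩ : WeierstrassCurve k).formalW.subst σ : k⟦X⟧) : k⸨X⸩) := by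
  have hw := WeierstrassCurve.coe_laurent_ne_zero (formalW_subst_ne_zero h0 hσ)
  have hs := WeierstrassCurve.coe_laurent_ne_zero hσ
  have hid := congrArg (fun f : k⟦X⟧ => (f : k⸨X⸩)) (formalXMulSq_subst_mul_formalW_subst (k := k) h0)
  simp only [PowerSeries.coe_mul, PowerSeries.coe_pow] at hid
  rw [WeierstrassCurve.laurentX, div_eq_div_iff (pow_ne_zero 2 hs) hw]
  linear_combination hid

/-- **`y(σ) = 1 / w(σ)`** in `k⸨X⸩` when `char k = 2` (`y = −1/w`, and `−1 = 1`). [cite: SilvermanAEC2009, IV.1.1] -/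
theorem laurentY_eq_div [CharP k 2] {σ : k⟦X⟧} (h0 : constantCoeff σ = 0) (hσ : σ ≠ 0) :
    (⟨0, 0, 1, 0, 0⟩ : WeierstrassCurve k).laurentY σ =
      1 / (((⟨0, 0, 1, 0, 0⟩ : WeierstrassCurve k).formalW.subst σ : k⟦X⟧) : k⸨X⸩) := by
  haveI : CharP k⸨X⸩ 2 := charP_of_injective_algebraMap (algebraMap k k⸨X⸩).injective 2
  have hw := WeierstrassCurve.coe_laurent_ne_zero (formalW_subst_ne_zero h0 hσ)
  have hs := WeierstrassCurve.coe_laurent_ne_zero hσ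
  have hid := congrArg (fun f : k⟦X⟧ => (f : k⸨X⸩)) (formalXMulSq_subst_mul_formalW_subst (k := k) h0)
  simp only [PowerSeries.coe_mul, PowerSeries.coe_pow] at hid
  have h2 : (2 : k⸨X⸩) = 0 := CharTwo.two_eq_zero
  rw [WeierstrassCurve.laurentY, div_eq_div_iff (pow_ne_zero 3 hs) hw]
  linear_combination (-1 : k⸨X⸩) * hid + (-(((σ : k⟦X⟧) : k⸨X⸩) ^ 3)) * h2

/-- **J1 on the tree's formal point.** `k` a field of characteristic `2`, `Ẽ = ⟨0,0,1,0,0⟩`, `σ ∈ k⟦X⟧` with `σ(0) = 0`, `σ ≠ 0`,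
`T(σ) = (x(σ), y(σ))`, `Q′ = (x′, y′)` with `x′ y′ ∈ k` ARBITRARY: with `z = σ`, `w = w(σ)` in `k⸨X⸩`,
`addX x′ x(σ) (slope x′ x(σ) y′ y(σ)) = x′ + w (1 + x′² z + y′² w)/(z + x′ w)²` for the base change `Ẽ ⊗ k⸨X⸩`
(Mathlib's chord law; `…JetTranslation.addX_translate`). [cite: SilvermanAEC2009, III.2.3] -/
theorem laurent_addX_translate [CharP k 2] (x y : k) {σ : k⟦X⟧} (h0 : constantCoeff σ = 0) (hσ : σ ≠ 0) :
    ((⟨0, 0, 1, 0, 0⟩ : WeierstrassCurve k).baseChange k⸨X⸩).toAffine.addX (algebraMap k k⸨X⸩ x)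
        ((⟨0, 0, 1, 0, 0⟩ : WeierstrassCurve k).laurentX σ)
        (((⟨0, 0, 1, 0, 0⟩ : WeierstrassCurve k).baseChange k⸨X⸩).toAffine.slope (algebraMap k k⸨X⸩ x)
          ((⟨0, 0, 1, 0, 0⟩ : WeierstrassCurve k).laurentX σ) (algebraMap k k⸨X⸩ y)
          ((⟨0, 0, 1, 0, 0⟩ : WeierstrassCurve k).laurentY σ)) =
      algebraMap k k⸨X⸩ x +
        (((⟨0, 0, 1, 0, 0⟩ : WeierstrassCurve k).formalW.subst σ : k⟦X⟧) : k⸨X⸩) *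
          (1 + algebraMap k k⸨X⸩ x ^ 2 * ((σ : k⟦X⟧) : k⸨X⸩) +
            algebraMap k k⸨X⸩ y ^ 2 * (((⟨0, 0, 1, 0, 0⟩ : WeierstrassCurve k).formalW.subst σ : k⟦X⟧) : k⸨X⸩)) /
          (((σ : k⟦X⟧) : k⸨X⸩) +
            algebraMap k k⸨X⸩ x * (((⟨0, 0, 1, 0, 0⟩ : WeierstrassCurve k).formalW.subst σ : k⟦X⟧) : k⸨X⸩)) ^ 2 := by
  haveI : CharP k⸨X⸩ 2 := charP_of_injective_algebraMap (algebraMap k k⸨X⸩).injective 2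
  set w : k⟦X⟧ := (⟨0, 0, 1, 0, 0⟩ : WeierstrassCurve k).formalW.subst σ with hwdef
  -- the hypotheses of `addX_translate`
  have hw0 : ((w : k⟦X⟧) : k⸨X⸩) ≠ 0 := WeierstrassCurve.coe_laurent_ne_zero (formalW_subst_ne_zero h0 hσ)
  have h2 : (2 : k⟦X⟧) = 0 := two_eq_zero_powerSeries
  have hfix : w ^ 2 + w = σ ^ 3 := by
    have h := formalW_subst_eq_cube_add_sq (k := k) h0
    rw [← hwdef] at h
    linear_combination h + (w ^ 2) * h2
  have hwK : ((w : k⟦X⟧) : k⸨X⸩) ^ 2 + ((w : k⟦X⟧) : k⸨X⸩) = ((σ : k⟦X⟧) : k⸨X⸩) ^ 3 := by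
    have h := congrArg (fun f : k⟦X⟧ => (f : k⸨X⸩)) hfix
    simpa only [PowerSeries.coe_add, PowerSeries.coe_pow] using h
  have hD : ((σ : k⟦X⟧) : k⸨X⸩) + algebraMap k k⸨X⸩ x * ((w : k⟦X⟧) : k⸨X⸩) ≠ 0 := by
    rw [WeierstrassCurve.algebraMap_laurentSeries_eq_coe_C, ← PowerSeries.coe_mul, ← PowerSeries.coe_add]
    refine WeierstrassCurve.coe_laurent_ne_zero ?_
    -- `σ + x′ w(σ) = σ · (1 + x′ σ² B(σ))`, a nonzero multiple of `σ`
    rw [hwdef, formalW_subst_eq_cube_mul h0,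
      show σ + C x * (σ ^ 3 * ((⟨0, 0, 1, 0, 0⟩ : WeierstrassCurve k).formalWDivCube.subst σ)) =
        σ * (1 + C x * σ ^ 2 * ((⟨0, 0, 1, 0, 0⟩ : WeierstrassCurve k).formalWDivCube.subst σ)) by ring]
    refine mul_ne_zero hσ fun h => ?_
    have h1 : constantCoeff (1 + C x * σ ^ 2 * ((⟨0, 0, 1, 0, 0⟩ : WeierstrassCurve k).formalWDivCube.subst σ)) = 1 := by
      simp [h0]
    rw [h, map_zero] at h1
    exact zero_ne_one h1
  have h₁ : ((⟨0, 0, 1, 0, 0⟩ : WeierstrassCurve k).baseChange k⸨X⸩).toAffine.a₁ = 0 := by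
    simp [WeierstrassCurve.baseChange]
  have h₂ : ((⟨0, 0, 1, 0, 0⟩ : WeierstrassCurve k).baseChange k⸨X⸩).toAffine.a₂ = 0 := by
    simp [WeierstrassCurve.baseChange]
  rw [laurentX_eq_div h0 hσ, laurentY_eq_div h0 hσ, ← hwdef]
  exact addX_translate _ h₁ h₂ _ _ _ _ hwK hw0 hD

end Summit.BirchSwinnertonDyer.BirchSwinnertonDyer.Theorems.SignedMuAtTwo.JetCharacterSums
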